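import Summits.QuantumFields.YangMills.Theorems.BalabanUVNodesK0AxSchemeOfRecordLetters
import Summits.QuantumFields.YangMills.Theorems.BalabanUVNodesN07EmapOfRecordTraceSectors
import Summits.QuantumFields.YangMills.Theorems.BalabanUVNodesN07LieTokAtOfRecordTwo
import Summits.QuantumFields.YangMills.Theorems.BalabanUVNodesN07ChartLinAverageAtRecord
import Literature.MathematicalPhysics.QuantumFieldTheory.Balaban1983to89.Node00.BgSchemePrOfRecordLie
import HarnessLib

/-!
# NODE O · K0ᴬ — THE BOX ROAD's SCHEME-OF-RECORD DOORS RE-KEYED BY NAME ONTO THE (47)-CARRYING, FRAMED SCHEME OF RECORD (№24ᵀ):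
# the T-twins of ✓`rootFactorAt_of_tokens_chart` ∕ ✓`chartCfg_unitField_eventuallyEq_expChart_ofRecord` ∕ ✓`contDiffAt_lieExpo_unitField_ofRecord_of_exp_mem`
# on def-Y's (A4) names `bgSchemePrOfRecord` ∕ `BgScheme.chartLin` ∕ `chartCfgLin` ∕ `lieExpoLin` ∕ `LieLinTokAt` ∕ `linPrOfRecord` ∕ `logPolydiscPrOfRecord`, and the
# record instance of (A4)'s antecedent «`T^{pr} = T47 H₁^{pr} C^{sl,pr} ε_C` maps the real sector into itself» on the ball `‖A′‖ < a_C`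

Cell `ym-nodeO-ideate`, LENS P3 «weaken the target» (g98; summoned on ★★★ R727-ym ∕ №630 (2) = `WAKE-A4-rekey-20260831T183110Z.md`); keyed
`--supports stmt-QuantumFields-27238 --as helper` (K0ᴬ road); count-neutral.  [15] = [Balaban1985Variational]; [B12] = [Balaban1987RG1].

WHY.  The K0ᴬ box road №19–№23 reads the rooted background field through def-Y's (47)-FREE scheme of record `bgSchemeOfRecord` (chart `S.chart`, token `S.LieTokAt`);
№20 §1 consumes exactly three door lemmas of ✓`…K0AxJunctionRootGradScheme` ∕ ✓`…K0AxSchemeOfRecordLetters`.  def-Y's (A4) ✓`Node00/BgSchemePrOfRecord` + (C1)–(C3)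
✓`Node00/BgSchemeChartLinLie` ∕ `…PrOfRecordC` ∕ `…PrOfRecordLie` typed the FRAMED scheme `bgSchemePrOfRecord`, whose chart carries [15]'s transformation (47)
`A = A′ − H₁^{pr}D(A′)` in the slot `T^{pr} := linPrOfRecord` — the edition at which Prop. 7 («`U_k = (U₁U₀)^u`», p. 299) is stated.  This file is the CONSUMER-SIDE
re-key ◆ CRIT-1 asked for (№630 (2) (a)+(b)): nothing landed is edited; the doors are typed once more, by name, on the tree's T-letters.

WHAT (namespace `…Theorems.K0AxCtabUniq`, like the originals).
§1 GENERIC `S : BgScheme F 2 𝒴 𝒵 K (k+1)`, any slot `T`: ★★`rootFactorAt_of_tokens_chartLin` — the KNIT tokens (rng)(cov)(c→s)(min) at the (47)-carrying chart map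
   `S.chartLin T V`, `RegimeTok`, the domain letter ⟹ `RootFactorAt F θ k K (B ↦ S.chartCfgLin T (W_B))` (✓`ukSel_eq_rootGauge_chart_solA`, `u = 1`);
   ★`rootFactorAt_chartLin_of_prop7LinRes` — the same from `UniqTok` + the RESIDUAL form of (A4)'s `Prop7LinTok` (the core of ✓`BgScheme.exists_UkSel_eq_rootGauge_chartLin`);
   `chartCfgLin_unitField_eventuallyEq_expChart_lieExpoLin` ((s-exp)ᵀ); `lieExpoLin_unitField_zero` (`X 0 = 0`).
§2 THE FRAMED RECORD, any `N`, level `k`, background `U₀`: `mem_evHerm0_prOfRecord_iff`; ★★`linPrOfRecord_mem_evHerm0` ∕ ★★`mapsTo_linPrOfRecord_evHerm0_ball` — (A4)'s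
   ANTECEDENT at the record: `T^{pr}_V` maps `evHerm0 ∩ {‖A′‖ < a_C}` into `evHerm0`, from dag-n07-w3's generic ✓`conjJet_T47_eq` + ✓`trace_equiv_T47_eq_zero` WITH the framed
   Sect. C regime `RC` and the reality ∕ trace rows `hH` `hHtr` `hCreal` `hCtr` of `H₁^{pr}`, `C^{sl,pr}` DISPLAYED; ★★`lieLinTokAt_prOfRecord_of_realRows` — the (47)-carrying
   Lie token from the reality of `𝒜^{pr}(V)`, `𝔄^{pr}(V)` ((A4) ✓`lieLinTokAt_of_mem_evHerm0`, radius ✓`norm_sol_add_frakApr_lt` under `RegimeTok`, `ε₄ + a𝔄 ≤ a_C`).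
§3 THE FRAMED RECORD AT `N = 2`, level `k+1`, `U₀ = 1` — THE DOOR TWINS: `chartCfgLin_one_prOfRecord` (h1), `lieExpoLin_unitField_zero_prOfRecord` (`X 0 = 0`),
   ★★`chartCfgLin_unitField_eventuallyEq_expChart_prOfRecord` ((s-exp)ᵀ), ★★`contDiffAt_lieExpoLin_unitField_prOfRecord[_of_exp_mem]` (`Cⁿ` of `X := lieExpoLin T^{pr} ∘
   unitField` at `0`; NEW displayed letters vs the `T := id` door: Prop. 3's `LinPrAnalyticTok … a_C`, `ε₄ + a𝔄 ≤ a_C`), ★`contDiffAt_coe_chartCfgLin_unitField_prOfRecord` (hC ∕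
   hdiff), ★★`lieLinTokAt_unitField_eventually_prOfRecord` — the eventual token `htok` of all three from §2's ball inclusion (displayed pointwise as `hlin`) and the reality rows.

HONEST.  By-name glue over def-Y's and dag-n07-w3's theorems; CONDITIONAL over DISPLAYED letters inhabited nowhere as a package: `RegimeTok`, `WAnalyticPrTok`,
`LinPrAnalyticTok`, the knit tokens at `S.chartLin T V`, `UniqTok` ∕ residual `Prop7Lin`, the framed Sect. C regime `RC` and the reality ∕ trace rows of `H₁^{pr}`, `C^{sl,pr}`
(hand-KLC ∕ PT-B territory — no tree lemma states them for `H1prOfRecordAtBg`), the reality of `𝒜^{pr}`, `𝔄^{pr}` along `W_B`.  `Set.MapsTo T^{pr}_V evHerm0 evHerm0` is typed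
BALL-RESTRICTED: off `‖A′‖ < a_C` the (47) fixed point is a junk value and the unrestricted inclusion is not a theorem.  NOT HERE (R727 «no re-key of anything else»): the
K0ᴬ-concluding doors of №20–№23 and the mod-gauge workhorse.  Nothing of [15] (Thm 1, Prop. 3, 4, 6, 7, 9) is asserted, ported or discharged; K0ᴬ stmt-QuantumFields-27238
OPEN — NOTHING of it proved; NODE O 0∕1; COUNT 8∕28 · K 1∕4 UNMOVED; finite 𝕋⁴_{L^K} at fixed ε — NOT continuum ∕ OS ∕ Clay; **the Yang–Mills mass gap is NOT proved.**
No `sorry`, no `instance ∕ notation ∕ set_option`; standard axioms.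
-/

noncomputable section

open Filter Topology
open scoped Matrix Matrix.Norms.L2Operator InnerProductSpace

namespace Summit.QuantumFields.YangMills.Theorems.K0AxCtabUniq

open Literature.MathematicalPhysics.QuantumFieldTheory.Balaban1983to89
open LatticeFieldCalculus
open Literature.MathematicalPhysics.QuantumFieldTheory.Balaban1983to89.T4Continuum (T4Family)
open Literature.MathematicalPhysics.QuantumFieldTheory.Balaban1983to89.Node00
open T4RootedResidualGauge (rootGauge rootGauge_gaugeAct_of_isResidual)
open GaugeField (gaugeAct)
open B12GaugeOrbits021 (IsResidual OrbitRel)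
open B9AdOrthogonal (mem_herm0)
open B11Eq103H1Complex (BondL2K SiteL2K)
open B11Eq111FrakG (nabla115)
open B11Eq115Space (NegSize NegSup JetSup)
open B11Eq174Chart (Regime)
open B11Prop6Scheme (mapT)
open NormedSpace (exp)
open Summit.QuantumFields.YangMills.Theorems.K0RecordFormatNames
open Summit.QuantumFields.YangMills.Theorems.K0AxRootGrad
open Summit.QuantumFields.YangMills.Theorems.BalabanUVNodesPortS1 (unitField_zero)
open Summit.QuantumFields.YangMills.Theorems.N07EmapOfRecordRealSlice (conjJet_T47_eq)
open Summit.QuantumFields.YangMills.Theorems.N07EmapOfRecordTraceSectors (trace_equiv_T47_eq_zero)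
open Summit.QuantumFields.YangMills.Theorems.N07LieTokAtOfRecordTwo (conjJet_eq_self_iff smul_mem_herm0_iff)
open Summit.QuantumFields.YangMills.Theorems.N07ChartLinAverageAtRecord (norm_sol_add_frakApr_lt)

variable (F : T4Family) (θ : Stage13Params F 2)

/-! ### §1  Generic scheme `S : BgScheme F 2 𝒴 𝒵 K (k+1)` with a (47)-slot `T`: the factorisation door, (s-exp)ᵀ, `X 0 = 0` -/

section GenericScheme
variable {𝒴 𝒵 : Type} [NormedAddCommGroup 𝒴] [NormedSpace ℂ 𝒴] [NormedAddCommGroup 𝒵] [NormedSpace ℂ 𝒵]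

/-- ★★ **THE FACTORISATION TOKEN FROM THE KNIT TOKENS AT THE (47)-CARRYING CHART** (T-twin of ✓`rootFactorAt_of_tokens_chart`): on `k + 1 ≤ m + K`, the four chart
tokens (rng)(cov)(c→s)(min) at the chart map `S.chartLin T V` for every `V ∈ S.dom`, `S.RegimeTok`, and «charted fields near `B = 0` lie in the (7)-domain» ⟹
`recordBgField B = rootGauge (k+1) (chartCfgLin S T (unitField B))` near `B = 0` — under (rng) the chart image of the fixed point is itself the minimiser, `u = 1`
(✓`ukSel_eq_rootGauge_chart_solA`; `chartCfgLin T V = chartLin T V (𝒜 V)`, `rfl`).  CONDITIONAL; every letter DISPLAYED.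
[cite: Balaban1985Variational, Thm 1 p.279, Prop. 6 p.295, Prop. 7 p.299, (47) p.285, (174) p.305; Balaban1987RG1, (1.1) p.260, (2.3) p.265] -/
theorem rootFactorAt_of_tokens_chartLin [CompleteSpace 𝒴] (k K : ℕ) (hk : k + 1 ≤ (F.P K).m + (F.P K).K) (S : BgScheme F 2 𝒴 𝒵 K (k + 1))
    (T : GaugeField (F.P K) (k + 1) (SU 2) → 𝒴 → 𝒴) (hR : S.RegimeTok) (Kc : GaugeField (F.P K) (k + 1) (SU 2) → Set 𝒴)
    (range : ∀ V ∈ S.dom, ∀ A ∈ Kc V, S.chartLin T V A ∈ bgReg F 2 K (k + 1) θ.εbg ∧ Averaging.iter (avOfRecord F 2 K) (k + 1) (S.chartLin T V A) = V)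
    (covers : ∀ V ∈ S.dom, ∀ U : GaugeField (F.P K) 0 (SU 2), U ∈ bgReg F 2 K (k + 1) θ.εbg →
      Averaging.iter (avOfRecord F 2 K) (k + 1) U = V → ∃ A ∈ Kc V, OrbitRel (k + 1) (S.chartLin T V A) U)
    (sol_of_isMinOn : ∀ V ∈ S.dom, ∀ A ∈ Kc V, IsMinOn (wilsonAction4 ∘ S.chartLin T V) (Kc V) A →
      ‖A‖ ≤ S.ε₄ ∧ mapT (S.𝒢 V) 0 (S.W V) (S.J V) (S.𝔄 V) A = A)
    (star_mem : ∀ V ∈ S.dom, S.sol V ∈ Kc V) (star_isMinOn : ∀ V ∈ S.dom, IsMinOn (wilsonAction4 ∘ S.chartLin T V) (Kc V) (S.sol V))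
    (hdom : letI := θ.instVβ₁; letI := θ.instVβ₂;
      ∀ᶠ B in 𝓝 (0 : Fin (F.P K).d → Site (F.P K) (k + 1) → θ.Vβ), unitField F θ k K B ∈ S.dom) :
    RootFactorAt F θ k K fun B => S.chartCfgLin T (unitField F θ k K B) := by
  letI := θ.instVβ₁; letI := θ.instVβ₂
  refine hdom.mono fun B hB => ?_
  show UkSel F 2 K (k + 1) θ.εbg (unitField F θ k K B) =
    rootGauge (k + 1) (S.chartLin T (unitField F θ k K B) (S.sol (unitField F θ k K B)))
  exact N07P0FixedPointIsRecordMinimiser.ukSel_eq_rootGauge_chart_solA hk (hR _ hB).1 (hR _ hB).2.1 (hR _ hB).2.2 (range _ hB)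
    (covers _ hB) (sol_of_isMinOn _ hB) (star_mem _ hB) (star_isMinOn _ hB)

/-- ★ **THE FACTORISATION TOKEN FROM `UniqTok` AND THE RESIDUAL FORM OF (A4)'s `Prop7LinTok`** (T-twin of ✓`eventually_recordBgField_eq_rootGauge_chartCfg`): if for
every `V` of the (7)-domain some gauge transform `u` RESIDUAL of level `k+1` makes `(S.chartCfgLin T V)^u` a (0.21)-minimiser over `V` (p. 299 «`U_k = (U₁U₀)^u`»; the word
«residual» added to (A4)'s `Prop7LinTok`), then near `B = 0` `recordBgField B = rootGauge (k+1) (chartCfgLin S T (unitField B))` — the core of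
✓`BgScheme.exists_UkSel_eq_rootGauge_chartLin` (✓`rootGauge_eq_UkSel_of_isBackground`) + «the rooted gauge is constant on residual orbits». CONDITIONAL; DISPLAYED.
[cite: Balaban1985Variational, Thm 1 p.279, Prop. 7 p.299, (19) p.281; Balaban1987RG1, (0.21) p.256] -/
theorem rootFactorAt_chartLin_of_prop7LinRes (k K : ℕ) (hk : k + 1 ≤ (F.P K).m + (F.P K).K) (S : BgScheme F 2 𝒴 𝒵 K (k + 1))
    (T : GaugeField (F.P K) (k + 1) (SU 2) → 𝒴 → 𝒴) (hU : S.UniqTok θ.εbg)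
    (h7 : ∀ V ∈ S.dom, ∃ u : GaugeTransf (F.P K) 0 (SU 2), IsResidual (k + 1) u ∧
      IsBackground (avOfRecord F 2 K) (bgReg F 2 K (k + 1) θ.εbg) (k + 1) V (gaugeAct u (S.chartCfgLin T V)))
    (hdom : letI := θ.instVβ₁; letI := θ.instVβ₂;
      ∀ᶠ B in 𝓝 (0 : Fin (F.P K).d → Site (F.P K) (k + 1) → θ.Vβ), unitField F θ k K B ∈ S.dom) :
    RootFactorAt F θ k K fun B => S.chartCfgLin T (unitField F θ k K B) := by
  letI := θ.instVβ₁; letI := θ.instVβ₂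
  refine hdom.mono fun B hB => ?_
  obtain ⟨u, hu, h₀⟩ := h7 _ hB
  show UkSel F 2 K (k + 1) θ.εbg (unitField F θ k K B) = _
  rw [← rootGauge_gaugeAct_of_isResidual hu (S.chartCfgLin T (unitField F θ k K B))]
  exact (rootGauge_eq_UkSel_of_isBackground hk (hU _ hB) h₀).symm

/-- **(s-exp)ᵀ FOR `X := lieExpoLin T ∘ unitField`**: `S.chartCfgLin T ∘ unitField =ᶠ[𝓝 0] (B ↦ expChart 1 (S.lieExpoLin T (unitField B)))` from the unit background and
the (47)-carrying Lie token, both eventually ((C1) ✓`BgScheme.chartCfgLin_eq_expChart_one`). [cite: Balaban1985Variational, (15) p.280, (19) p.281, (47) p.285, Prop. 9 p.309] -/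
theorem chartCfgLin_unitField_eventuallyEq_expChart_lieExpoLin (k K : ℕ) (S : BgScheme F 2 𝒴 𝒵 K (k + 1))
    (T : GaugeField (F.P K) (k + 1) (SU 2) → 𝒴 → 𝒴)
    (hbg : letI := θ.instVβ₁; letI := θ.instVβ₂;
      ∀ᶠ B in 𝓝 (0 : Fin (F.P K).d → Site (F.P K) (k + 1) → θ.Vβ), S.bg (unitField F θ k K B) = 1)
    (htok : letI := θ.instVβ₁; letI := θ.instVβ₂;
      ∀ᶠ B in 𝓝 (0 : Fin (F.P K).d → Site (F.P K) (k + 1) → θ.Vβ), S.LieLinTokAt T (unitField F θ k K B)) :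
    letI := θ.instVβ₁; letI := θ.instVβ₂
    (fun B => S.chartCfgLin T (unitField F θ k K B)) =ᶠ[𝓝 (0 : Fin (F.P K).d → Site (F.P K) (k + 1) → θ.Vβ)]
      fun B => expChart (1 : GaugeField (F.P K) 0 (SU 2)) (S.lieExpoLin T (unitField F θ k K B)) := by
  letI := θ.instVβ₁; letI := θ.instVβ₂
  exact (hbg.and htok).mono fun B hB => S.chartCfgLin_eq_expChart_one T hB.1 hB.2

/-- **`X 0 = 0`** for `X := lieExpoLin T ∘ unitField`: `W_0 = 1` (✓`unitField_zero`) and the exponent vanishes where `𝒜(1) = 0 = 𝔄(1)`, `T_1(0) = 0`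
((C1) ✓`BgScheme.lieExpoLin_eq_zero`). [cite: Balaban1985Variational, (15) p.280, (47) p.285, Prop. 9 p.309; Balaban1987RG1, p.264] -/
theorem lieExpoLin_unitField_zero (k K : ℕ) (S : BgScheme F 2 𝒴 𝒵 K (k + 1)) (T : GaugeField (F.P K) (k + 1) (SU 2) → 𝒴 → 𝒴)
    (hsol : S.sol 1 = 0) (h𝔄 : S.𝔄 1 = 0) (hT0 : T 1 0 = 0) :
    letI := θ.instVβ₁; letI := θ.instVβ₂
    S.lieExpoLin T (unitField F θ k K (0 : Fin (F.P K).d → Site (F.P K) (k + 1) → θ.Vβ)) = 0 := by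
  letI := θ.instVβ₁; letI := θ.instVβ₂
  rw [unitField_zero F θ k K]
  exact S.lieExpoLin_eq_zero T hsol h𝔄 hT0
end GenericScheme

/-! ### §2  The framed record (any `N`, level `k`, background `U₀`): (A4)'s antecedent on the ball, and the (47)-carrying Lie token from the reality rows -/

section RealSlice
variable (N : ℕ) [NeZero N] (K k : ℕ) (Ω : ℕ → Set (Site (F.P K) 0)) (U₀ : GaugeField (F.P K) 0 (SU N))
variable [Fact (0 < (F.L : ℝ))] [Fact (0 < (F.P K).eta k)] [Fact (0 < c0Rec F K k)] [Fact (∀ c, 0 < wBRec F K k c)]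
variable (𝔥 : FrameDatum (F.P K) N k U₀) (dom : Set (GaugeField (F.P K) k (SU N))) (levB : PBond (F.P K) k → ℕ)
  (Gp : SiteL2K ℂ (F.P K).d (fun _ => (F.P K).sitesPerDir 0) (c0Rec F K k) (WRec N) →ₗ[ℂ]
    SiteL2K ℂ (F.P K).d (fun _ => (F.P K).sitesPerDir 0) (c0Rec F K k) (WRec N))
  (Δ2 : BondL2K ℂ (F.P K).d (fun _ => (F.P K).sitesPerDir 0) (c0Rec F K k) (WRec N) →ₗ[ℂ]
    BondL2K ℂ (F.P K).d (fun _ => (F.P K).sitesPerDir 0) (c0Rec F K k) (WRec N)) (a : ℝ)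
  (hposπ : ∀ x, x ≠ 0 → 0 < RCLike.re ⟪x, laplaceAOfRecordAt F N k U₀ (hessOpOfRecord128 F N k U₀ Gp (QprimeOfRecord F N k U₀) Δ2)
    (QprOfRecord F N k U₀ 𝔥) (QprimeOfRecord F N k U₀) a x⟫_ℂ)
  (hposb : ∀ x, x ≠ 0 → 0 < RCLike.re ⟪x, laplaceAOfRecord F N k U₀ (QprOfRecord F N k U₀ 𝔥) (QprimeOfRecord F N k U₀) a x⟫_ℂ)
  (hQ : Function.Surjective (QprOfRecord F N k U₀ 𝔥)) (εC B₀ C₄ a₃ j a𝔄 ε₄ : ℝ)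

/-- **THE REAL SECTOR OF THE FRAMED SCHEME OF RECORD, READ ON THE JETS**: `Y ∈ S.evHerm0` iff the presented field of `Y` is HERMITIAN and TRACELESS at every bond
(`S.ev = η·evLit`, `η > 0`; the framed twin of ✓`mem_evHerm0_ofRecord_iff`, same proof on ✓`bgSchemePrOfRecord_ev`). [cite: Balaban1985Variational, (19) p.281, (51) p.286, (115) p.294] -/
theorem mem_evHerm0_prOfRecord_iff (Y : Space115Lit F N K k Ω U₀) :
    Y ∈ (bgSchemePrOfRecord F N K k Ω U₀ 𝔥 dom levB Gp Δ2 a hposπ hposb hQ εC B₀ C₄ a₃ j a𝔄 ε₄).evHerm0 ↔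
      ((JetSup.equiv _ _ (nabla115 ((F.P K).eta k) (unitsOfRecord F N U₀))).symm
          (star (JetSup.equiv _ _ (nabla115 ((F.P K).eta k) (unitsOfRecord F N U₀)) Y)) : Space115Lit F N K k Ω U₀) = Y ∧
        ∀ b, (JetSup.equiv _ _ (nabla115 ((F.P K).eta k) (unitsOfRecord F N U₀)) Y b).trace = 0 := by
  have hη : ((F.P K).eta k : ℝ) ≠ 0 := (Fact.out : 0 < (F.P K).eta k).ne'
  rw [BgScheme.mem_evHerm0_iff, conjJet_eq_self_iff, bgSchemePrOfRecord_ev]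
  simp only [LinearMap.smul_apply, Pi.smul_apply, evLit_apply, smul_mem_herm0_iff hη, mem_herm0]
  constructor
  · intro h
    refine ⟨fun b => ?_, fun b => ?_⟩
    · have h1 := (h ((bondToLit (F.P K) 0).symm b)).1
      rw [Equiv.apply_symm_apply] at h1
      rw [Matrix.star_eq_conjTranspose]; exact h1
    · have h2 := (h ((bondToLit (F.P K) 0).symm b)).2
      rwa [Equiv.apply_symm_apply] at h2
  · rintro ⟨h1, h2⟩ c
    refine ⟨?_, h2 _⟩
    have := h1 (bondToLit (F.P K) 0 c)
    rw [Matrix.star_eq_conjTranspose] at this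
    exact this

variable {b C₂ c₄ aC : ℝ}
  (RC : Regime (H1prOfRecordAtBg F N K k Ω U₀ 𝔥 levB a hposb hQ) 0 (CslprOfRecord F N K k Ω U₀ 𝔥 levB) b 0 C₂ c₄ 0 aC εC)
  (hH : ∀ B : NegSize (F.L : ℝ) ((F.P K).eta k) levB 0 (Matrix (Fin N) (Fin N) ℂ),
    ((JetSup.equiv _ _ (nabla115 ((F.P K).eta k) (unitsOfRecord F N U₀))).symm
        (star (JetSup.equiv _ _ (nabla115 ((F.P K).eta k) (unitsOfRecord F N U₀)) (H1prOfRecordAtBg F N K k Ω U₀ 𝔥 levB a hposb hQ B))) :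
        Space115Lit F N K k Ω U₀) = H1prOfRecordAtBg F N K k Ω U₀ 𝔥 levB a hposb hQ ((NegSup.equiv _ _).symm (star (NegSup.equiv _ _ B))))
  (hHtr : ∀ B : NegSize (F.L : ℝ) ((F.P K).eta k) levB 0 (Matrix (Fin N) (Fin N) ℂ), (∀ c, (NegSup.equiv _ _ B c).trace = 0) →
    ∀ b', (JetSup.equiv _ _ (nabla115 ((F.P K).eta k) (unitsOfRecord F N U₀)) (H1prOfRecordAtBg F N K k Ω U₀ 𝔥 levB a hposb hQ B) b').trace = 0)
  (hCreal : ∀ A : Space115Lit F N K k Ω U₀,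
    ((JetSup.equiv _ _ (nabla115 ((F.P K).eta k) (unitsOfRecord F N U₀))).symm
        (star (JetSup.equiv _ _ (nabla115 ((F.P K).eta k) (unitsOfRecord F N U₀)) A)) : Space115Lit F N K k Ω U₀) = A → ‖A‖ ≤ εC + aC →
      ((NegSup.equiv _ _).symm (star (NegSup.equiv _ _ (CslprOfRecord F N K k Ω U₀ 𝔥 levB A))) :
        NegSize (F.L : ℝ) ((F.P K).eta k) levB 0 (Matrix (Fin N) (Fin N) ℂ)) = CslprOfRecord F N K k Ω U₀ 𝔥 levB A)
  (hCtr : ∀ A : Space115Lit F N K k Ω U₀,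
    ((JetSup.equiv _ _ (nabla115 ((F.P K).eta k) (unitsOfRecord F N U₀))).symm
        (star (JetSup.equiv _ _ (nabla115 ((F.P K).eta k) (unitsOfRecord F N U₀)) A)) : Space115Lit F N K k Ω U₀) = A →
      (∀ b', (JetSup.equiv _ _ (nabla115 ((F.P K).eta k) (unitsOfRecord F N U₀)) A b').trace = 0) → ‖A‖ ≤ εC + aC →
        ∀ c, (NegSup.equiv _ _ (CslprOfRecord F N K k Ω U₀ 𝔥 levB A) c).trace = 0)

include RC hH hHtr hCreal hCtr in
/-- ★★ **(A4)'s ANTECEDENT AT THE RECORD, ON THE BALL: `T^{pr}_V A′ = T47 H₁^{pr} C^{sl,pr} ε_C A′` IS A HERMITIAN TRACELESS JET for a Hermitian traceless `A′` with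
`‖A′‖ < a_C`** — dag-n07-w3's generic ✓`conjJet_T47_eq` (reality) + ✓`trace_equiv_T47_eq_zero` (trace sector) WITH the framed Sect. C regime `RC` and the reality ∕ trace rows
of `H := H₁^{pr}`, `C := C^{sl,pr}` DISPLAYED (`hH`: `H` real; `hHtr`: `H` traceless-to-traceless; `hCreal` ∕ `hCtr`: `C` Hermitian(-traceless)-to-Hermitian(-traceless) on norm
`≤ ε_C + a_C`). [cite: Balaban1985Variational, (45)–(51) pp.285–286, Prop. 3 p.289, (115) p.294; Balaban1985BackgroundPropagators, p.392] -/
theorem linPrOfRecord_mem_evHerm0 (V : GaugeField (F.P K) k (SU N)) {A' : Space115Lit F N K k Ω U₀}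
    (hA' : A' ∈ (bgSchemePrOfRecord F N K k Ω U₀ 𝔥 dom levB Gp Δ2 a hposπ hposb hQ εC B₀ C₄ a₃ j a𝔄 ε₄).evHerm0) (hn : ‖A'‖ < aC) :
    linPrOfRecord F N K k Ω U₀ 𝔥 levB a hposb hQ εC V A' ∈
      (bgSchemePrOfRecord F N K k Ω U₀ 𝔥 dom levB Gp Δ2 a hposπ hposb hQ εC B₀ C₄ a₃ j a𝔄 ε₄).evHerm0 := by
  rw [mem_evHerm0_prOfRecord_iff] at hA' ⊢
  exact ⟨conjJet_T47_eq F N K k Ω U₀ levB RC hH hCreal hA'.1 hn,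
    fun b' => trace_equiv_T47_eq_zero F N K k Ω U₀ levB RC hH hHtr hCreal hCtr hA'.1 hA'.2 hn b'⟩

include RC hH hHtr hCreal hCtr in
/-- ★★ **`Set.MapsTo T^{pr}_V (evHerm0 ∩ ball 0 a_C) evHerm0`** — the record instance of (A4)'s antecedent `Set.MapsTo (linPrOfRecord … V) evHerm0 evHerm0` on the ball
where the (47) fixed point is meaningful (off `‖A′‖ < a_C` the selected solution is a junk value).  DISPLAYED: `RC`, `hH`, `hHtr`, `hCreal`, `hCtr`.
[cite: Balaban1985Variational, (47) p.285, (51) p.286, Prop. 3 p.289, Prop. 6 p.295] -/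
theorem mapsTo_linPrOfRecord_evHerm0_ball (V : GaugeField (F.P K) k (SU N)) :
    Set.MapsTo (linPrOfRecord F N K k Ω U₀ 𝔥 levB a hposb hQ εC V)
      (((bgSchemePrOfRecord F N K k Ω U₀ 𝔥 dom levB Gp Δ2 a hposπ hposb hQ εC B₀ C₄ a₃ j a𝔄 ε₄).evHerm0 : Set (Space115Lit F N K k Ω U₀)) ∩
        Metric.ball 0 aC)
      ((bgSchemePrOfRecord F N K k Ω U₀ 𝔥 dom levB Gp Δ2 a hposπ hposb hQ εC B₀ C₄ a₃ j a𝔄 ε₄).evHerm0 : Set (Space115Lit F N K k Ω U₀)) :=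
  fun _ hA' => linPrOfRecord_mem_evHerm0 F N K k Ω U₀ 𝔥 dom levB Gp Δ2 a hposπ hposb hQ εC B₀ C₄ a₃ j a𝔄 ε₄ RC hH hHtr hCreal hCtr V hA'.1
    (mem_ball_zero_iff.1 hA'.2)

include RC hH hHtr hCreal hCtr in
/-- ★★ **THE (47)-CARRYING LIE TOKEN FROM THE REALITY ROWS OF THE FIXED POINT AND THE SHIFT** at `V ∈ dom`: `𝒜^{pr}(V) ∈ evHerm0`, `𝔄^{pr}(V) ∈ evHerm0` (DISPLAYED —
the reality-rows programme, dag-n07-w3 lane), the radius `‖𝒜^{pr} + 𝔄^{pr}‖ < a_C` by ✓`norm_sol_add_frakApr_lt` from `RegimeTok` and `ε₄ + a𝔄 ≤ a_C`, and the rows above ⟹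
`LieLinTokAt T^{pr} V` ((A4) ✓`BgScheme.lieLinTokAt_of_mem_evHerm0`). [cite: Balaban1985Variational, (15) p.280, (47) p.285, Prop. 6 (116)–(121) p.295, Prop. 9 p.309] -/
theorem lieLinTokAt_prOfRecord_of_realRows
    (hT : (bgSchemePrOfRecord F N K k Ω U₀ 𝔥 dom levB Gp Δ2 a hposπ hposb hQ εC B₀ C₄ a₃ j a𝔄 ε₄).RegimeTok)
    {V : GaugeField (F.P K) k (SU N)} (hV : V ∈ dom) (haC : ε₄ + a𝔄 ≤ aC)
    (hsol : (bgSchemePrOfRecord F N K k Ω U₀ 𝔥 dom levB Gp Δ2 a hposπ hposb hQ εC B₀ C₄ a₃ j a𝔄 ε₄).sol V ∈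
      (bgSchemePrOfRecord F N K k Ω U₀ 𝔥 dom levB Gp Δ2 a hposπ hposb hQ εC B₀ C₄ a₃ j a𝔄 ε₄).evHerm0)
    (h𝔄 : (bgSchemePrOfRecord F N K k Ω U₀ 𝔥 dom levB Gp Δ2 a hposπ hposb hQ εC B₀ C₄ a₃ j a𝔄 ε₄).𝔄 V ∈
      (bgSchemePrOfRecord F N K k Ω U₀ 𝔥 dom levB Gp Δ2 a hposπ hposb hQ εC B₀ C₄ a₃ j a𝔄 ε₄).evHerm0) :
    (bgSchemePrOfRecord F N K k Ω U₀ 𝔥 dom levB Gp Δ2 a hposπ hposb hQ εC B₀ C₄ a₃ j a𝔄 ε₄).LieLinTokAt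
      (linPrOfRecord F N K k Ω U₀ 𝔥 levB a hposb hQ εC) V :=
  BgScheme.lieLinTokAt_of_mem_evHerm0 _ _
    (linPrOfRecord_mem_evHerm0 F N K k Ω U₀ 𝔥 dom levB Gp Δ2 a hposπ hposb hQ εC B₀ C₄ a₃ j a𝔄 ε₄ RC hH hHtr hCreal hCtr V (add_mem hsol h𝔄)
      (norm_sol_add_frakApr_lt F N K k Ω U₀ 𝔥 dom levB Gp Δ2 a hposπ hposb hQ εC B₀ C₄ a₃ j a𝔄 ε₄ (hT V hV).1 (hT V hV).2.1
        (hT V hV).2.2 haC))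
end RealSlice

/-! ### §3  The framed record at `N = 2`, level `k+1`, `U₀ = 1`: the door twins along the charted unit-lattice fields `B ↦ W_B` -/

section PrOfRecord
variable (K k : ℕ) (Ω : ℕ → Set (Site (F.P K) 0))
variable [Fact (0 < (F.L : ℝ))] [Fact (0 < (F.P K).eta (k + 1))] [Fact (0 < c0Rec F K (k + 1))] [Fact (∀ c, 0 < wBRec F K (k + 1) c)]
variable (𝔥 : FrameDatum (F.P K) 2 (k + 1) (1 : GaugeField (F.P K) 0 (SU 2))) (dom : Set (GaugeField (F.P K) (k + 1) (SU 2)))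
  (levB : PBond (F.P K) (k + 1) → ℕ)
  (Gp : SiteL2K ℂ (F.P K).d (fun _ => (F.P K).sitesPerDir 0) (c0Rec F K (k + 1)) (WRec 2) →ₗ[ℂ]
    SiteL2K ℂ (F.P K).d (fun _ => (F.P K).sitesPerDir 0) (c0Rec F K (k + 1)) (WRec 2))
  (Δ2 : BondL2K ℂ (F.P K).d (fun _ => (F.P K).sitesPerDir 0) (c0Rec F K (k + 1)) (WRec 2) →ₗ[ℂ]
    BondL2K ℂ (F.P K).d (fun _ => (F.P K).sitesPerDir 0) (c0Rec F K (k + 1)) (WRec 2)) (a : ℝ)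
  (hposπ : ∀ x, x ≠ 0 → 0 < RCLike.re ⟪x, laplaceAOfRecordAt F 2 (k + 1) (1 : GaugeField (F.P K) 0 (SU 2))
    (hessOpOfRecord128 F 2 (k + 1) (1 : GaugeField (F.P K) 0 (SU 2)) Gp (QprimeOfRecord F 2 (k + 1) (1 : GaugeField (F.P K) 0 (SU 2))) Δ2)
    (QprOfRecord F 2 (k + 1) (1 : GaugeField (F.P K) 0 (SU 2)) 𝔥) (QprimeOfRecord F 2 (k + 1) (1 : GaugeField (F.P K) 0 (SU 2))) a x⟫_ℂ)
  (hposb : ∀ x, x ≠ 0 → 0 < RCLike.re ⟪x, laplaceAOfRecord F 2 (k + 1) (1 : GaugeField (F.P K) 0 (SU 2))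
    (QprOfRecord F 2 (k + 1) (1 : GaugeField (F.P K) 0 (SU 2)) 𝔥) (QprimeOfRecord F 2 (k + 1) (1 : GaugeField (F.P K) 0 (SU 2))) a x⟫_ℂ)
  (hQ : Function.Surjective (QprOfRecord F 2 (k + 1) (1 : GaugeField (F.P K) 0 (SU 2)) 𝔥)) (εC B₀ C₄ a₃ j a𝔄 ε₄ : ℝ)

/-- **FILE 55's `h1` AT THE FRAMED SCHEME OF RECORD**: `chartCfgLin T^{pr} 1 = 1` modulo `RegimeTok`, `1 ∈ dom` and the primitive `T^{pr}_1(0) = 0` ((C3)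
✓`bgSchemePrOfRecord_chartCfgLin_one`; `hT0`'s supplier is ✓`linPrOfRecord_apply_zero` under the framed Sect. C regime). [cite: Balaban1985Variational, (15) p.280, (47) p.285, Prop. 9 p.309] -/
theorem chartCfgLin_one_prOfRecord
    (hT : (bgSchemePrOfRecord F 2 K (k + 1) Ω 1 𝔥 dom levB Gp Δ2 a hposπ hposb hQ εC B₀ C₄ a₃ j a𝔄 ε₄).RegimeTok)
    (h1 : (1 : GaugeField (F.P K) (k + 1) (SU 2)) ∈ dom) (hT0 : linPrOfRecord F 2 K (k + 1) Ω 1 𝔥 levB a hposb hQ εC 1 0 = 0) :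
    (bgSchemePrOfRecord F 2 K (k + 1) Ω 1 𝔥 dom levB Gp Δ2 a hposπ hposb hQ εC B₀ C₄ a₃ j a𝔄 ε₄).chartCfgLin
      (linPrOfRecord F 2 K (k + 1) Ω 1 𝔥 levB a hposb hQ εC) 1 = 1 :=
  bgSchemePrOfRecord_chartCfgLin_one F 2 K (k + 1) Ω 𝔥 dom levB Gp Δ2 a hposπ hposb hQ εC B₀ C₄ a₃ j a𝔄 ε₄ hT h1 hT0

/-- ★ **`X 0 = 0` AT THE FRAMED SCHEME OF RECORD** for `X := lieExpoLin T^{pr} ∘ unitField`, modulo `RegimeTok`, `1 ∈ dom`, `T^{pr}_1(0) = 0`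
((C3) ✓`bgSchemePrOfRecord_lieExpoLin_one`). [cite: Balaban1985Variational, (15) p.280, (47) p.285, Prop. 6 (116) p.295, Prop. 9 p.309] -/
theorem lieExpoLin_unitField_zero_prOfRecord
    (hT : (bgSchemePrOfRecord F 2 K (k + 1) Ω 1 𝔥 dom levB Gp Δ2 a hposπ hposb hQ εC B₀ C₄ a₃ j a𝔄 ε₄).RegimeTok)
    (h1 : (1 : GaugeField (F.P K) (k + 1) (SU 2)) ∈ dom) (hT0 : linPrOfRecord F 2 K (k + 1) Ω 1 𝔥 levB a hposb hQ εC 1 0 = 0) :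
    letI := θ.instVβ₁; letI := θ.instVβ₂
    (bgSchemePrOfRecord F 2 K (k + 1) Ω 1 𝔥 dom levB Gp Δ2 a hposπ hposb hQ εC B₀ C₄ a₃ j a𝔄 ε₄).lieExpoLin
      (linPrOfRecord F 2 K (k + 1) Ω 1 𝔥 levB a hposb hQ εC) (unitField F θ k K (0 : Fin (F.P K).d → Site (F.P K) (k + 1) → θ.Vβ)) = 0 := by
  letI := θ.instVβ₁; letI := θ.instVβ₂
  rw [unitField_zero F θ k K]
  exact bgSchemePrOfRecord_lieExpoLin_one F 2 K (k + 1) Ω 𝔥 dom levB Gp Δ2 a hposπ hposb hQ εC B₀ C₄ a₃ j a𝔄 ε₄ hT h1 hT0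

/-- ★★ **(s-exp)ᵀ AT THE FRAMED SCHEME OF RECORD** for `X := lieExpoLin T^{pr} ∘ unitField` (T-twin of ✓`chartCfg_unitField_eventuallyEq_expChart_ofRecord`), modulo the
eventual (47)-carrying Lie token ONLY (the background letter is `rfl`; (C3) ✓`bgSchemePrOfRecord_chartCfgLin_comp_eventuallyEq_expChart`).
[cite: Balaban1985Variational, (15) p.280, (19) p.281, (47) p.285, Prop. 9 p.309] -/
theorem chartCfgLin_unitField_eventuallyEq_expChart_prOfRecord
    (htok : letI := θ.instVβ₁; letI := θ.instVβ₂;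
      ∀ᶠ B in 𝓝 (0 : Fin (F.P K).d → Site (F.P K) (k + 1) → θ.Vβ),
        (bgSchemePrOfRecord F 2 K (k + 1) Ω 1 𝔥 dom levB Gp Δ2 a hposπ hposb hQ εC B₀ C₄ a₃ j a𝔄 ε₄).LieLinTokAt
          (linPrOfRecord F 2 K (k + 1) Ω 1 𝔥 levB a hposb hQ εC) (unitField F θ k K B)) :
    letI := θ.instVβ₁; letI := θ.instVβ₂
    (fun B => (bgSchemePrOfRecord F 2 K (k + 1) Ω 1 𝔥 dom levB Gp Δ2 a hposπ hposb hQ εC B₀ C₄ a₃ j a𝔄 ε₄).chartCfgLin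
        (linPrOfRecord F 2 K (k + 1) Ω 1 𝔥 levB a hposb hQ εC) (unitField F θ k K B))
      =ᶠ[𝓝 (0 : Fin (F.P K).d → Site (F.P K) (k + 1) → θ.Vβ)]
      fun B => expChart (1 : GaugeField (F.P K) 0 (SU 2))
        ((bgSchemePrOfRecord F 2 K (k + 1) Ω 1 𝔥 dom levB Gp Δ2 a hposπ hposb hQ εC B₀ C₄ a₃ j a𝔄 ε₄).lieExpoLin
          (linPrOfRecord F 2 K (k + 1) Ω 1 𝔥 levB a hposb hQ εC) (unitField F θ k K B)) := by
  letI := θ.instVβ₁; letI := θ.instVβ₂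
  exact bgSchemePrOfRecord_chartCfgLin_comp_eventuallyEq_expChart F 2 K (k + 1) Ω 𝔥 dom levB Gp Δ2 a hposπ hposb hQ εC B₀ C₄ a₃ j a𝔄 ε₄ htok

/-- ★★ **`ContDiffAt ℝ n X 0` AT THE FRAMED SCHEME OF RECORD** for `X := lieExpoLin T^{pr} ∘ unitField` (T-twin of ✓`contDiffAt_lieExpo_unitField_ofRecord`; the socket's
`ContDiffAt ℝ 2 X 0`), modulo the DISPLAYED `RegimeTok`, `1 ∈ dom`, `WAnalyticPrTok` (Prop. 4), `0 < a𝔄`, Prop. 3's analyticity of (47) on the ball `LinPrAnalyticTok … a_C`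
(supplier: (C2) ✓`linPrAnalyticTok_of_regimeC`), the radius inequality `ε₄ + a𝔄 ≤ a_C`, and the datum-side `Cⁿ` letter ((C3)
✓`bgSchemePrOfRecord_contDiffAt_lieExpoLin_comp_of_regimeTok` at the flat datum `coeField 1 ∈ logPolydiscPrOfRecord`).
[cite: Balaban1985Variational, Prop. 9 p.309, Prop. 3 p.289, Prop. 4 p.292, Prop. 6 (116)–(121) p.295, (15) p.280, (47) p.285] -/
theorem contDiffAt_lieExpoLin_unitField_prOfRecord {n : WithTop ℕ∞}
    (hT : (bgSchemePrOfRecord F 2 K (k + 1) Ω 1 𝔥 dom levB Gp Δ2 a hposπ hposb hQ εC B₀ C₄ a₃ j a𝔄 ε₄).RegimeTok)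
    (h1 : (1 : GaugeField (F.P K) (k + 1) (SU 2)) ∈ dom) (hW : WAnalyticPrTok F 2 K (k + 1) Ω 1 𝔥 levB Gp a hposb hQ εC a₃) (ha : 0 < a𝔄) {aC : ℝ}
    (hTan : LinPrAnalyticTok F 2 K (k + 1) Ω 1 𝔥 levB a hposb hQ εC aC) (haC : ε₄ + a𝔄 ≤ aC)
    (hu : letI := θ.instVβ₁; letI := θ.instVβ₂;
      ContDiffAt ℝ n (fun B : Fin (F.P K).d → Site (F.P K) (k + 1) → θ.Vβ => coeField (unitField F θ k K B)) 0) :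
    letI := θ.instVβ₁; letI := θ.instVβ₂
    ContDiffAt ℝ n (fun B : Fin (F.P K).d → Site (F.P K) (k + 1) → θ.Vβ =>
      (bgSchemePrOfRecord F 2 K (k + 1) Ω 1 𝔥 dom levB Gp Δ2 a hposπ hposb hQ εC B₀ C₄ a₃ j a𝔄 ε₄).lieExpoLin
        (linPrOfRecord F 2 K (k + 1) Ω 1 𝔥 levB a hposb hQ εC) (unitField F θ k K B)) 0 := by
  letI := θ.instVβ₁; letI := θ.instVβ₂
  refine bgSchemePrOfRecord_contDiffAt_lieExpoLin_comp_of_regimeTok F 2 K (k + 1) Ω 1 𝔥 dom levB Gp Δ2 a hposπ hposb hQ εC B₀ C₄ a₃ j a𝔄 ε₄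
    hT h1 hW hu ?_ hTan haC
  show coeField (unitField F θ k K (0 : Fin (F.P K).d → Site (F.P K) (k + 1) → θ.Vβ)) ∈ _
  rw [unitField_zero F θ k K]
  exact coeField_one_mem_logPolydiscPrOfRecord F 2 K (k + 1) Ω 𝔥 levB Gp Δ2 a hposπ hQ a𝔄 ha

/-- ★★ The same with the datum-side letter DISCHARGED under the chart letter `exp(ρ₈ v) ∈ SU(2)` (✓`contDiffAt_coeField_unitField`) — the T-twin of №20 §1's door
✓`contDiffAt_lieExpo_unitField_ofRecord_of_exp_mem`. [cite: Balaban1985Variational, Prop. 9 p.309, Prop. 3 p.289; Balaban1987RG1, p.264] -/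
theorem contDiffAt_lieExpoLin_unitField_prOfRecord_of_exp_mem {n : WithTop ℕ∞}
    (hρ : letI := θ.instVβ₁; letI := θ.instVβ₂; ∀ v : θ.Vβ, exp (θ.ρ8 v) ∈ Matrix.specialUnitaryGroup (Fin 2) ℂ)
    (hT : (bgSchemePrOfRecord F 2 K (k + 1) Ω 1 𝔥 dom levB Gp Δ2 a hposπ hposb hQ εC B₀ C₄ a₃ j a𝔄 ε₄).RegimeTok)
    (h1 : (1 : GaugeField (F.P K) (k + 1) (SU 2)) ∈ dom) (hW : WAnalyticPrTok F 2 K (k + 1) Ω 1 𝔥 levB Gp a hposb hQ εC a₃) (ha : 0 < a𝔄) {aC : ℝ}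
    (hTan : LinPrAnalyticTok F 2 K (k + 1) Ω 1 𝔥 levB a hposb hQ εC aC) (haC : ε₄ + a𝔄 ≤ aC) :
    letI := θ.instVβ₁; letI := θ.instVβ₂
    ContDiffAt ℝ n (fun B : Fin (F.P K).d → Site (F.P K) (k + 1) → θ.Vβ =>
      (bgSchemePrOfRecord F 2 K (k + 1) Ω 1 𝔥 dom levB Gp Δ2 a hposπ hposb hQ εC B₀ C₄ a₃ j a𝔄 ε₄).lieExpoLin
        (linPrOfRecord F 2 K (k + 1) Ω 1 𝔥 levB a hposb hQ εC) (unitField F θ k K B)) 0 := by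
  letI := θ.instVβ₁; letI := θ.instVβ₂
  exact contDiffAt_lieExpoLin_unitField_prOfRecord F θ K k Ω 𝔥 dom levB Gp Δ2 a hposπ hposb hQ εC B₀ C₄ a₃ j a𝔄 ε₄ hT h1 hW ha hTan haC
    (contDiffAt_coeField_unitField F θ k K hρ 0)

/-- ★ **FILE 55's `hC` (`n = 2`) ∕ `hdiff` (`n = 1`) AT THE FRAMED SCHEME OF RECORD**: the (47)-carrying chart matrix entries `B ↦ ((chartCfgLin T^{pr} (W_B))(b))_b` are `Cⁿ` at
`B = 0`, modulo the letters of ✓`contDiffAt_lieExpoLin_unitField_prOfRecord` and the eventual Lie token ((C3) ✓`bgSchemePrOfRecord_contDiffAt_coe_chartCfgLin_comp_pi_of_regimeTok`).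
[cite: Balaban1985Variational, Prop. 9 p.309, (15) p.280, (19) p.281, (47) p.285] -/
theorem contDiffAt_coe_chartCfgLin_unitField_prOfRecord {n : WithTop ℕ∞}
    (hT : (bgSchemePrOfRecord F 2 K (k + 1) Ω 1 𝔥 dom levB Gp Δ2 a hposπ hposb hQ εC B₀ C₄ a₃ j a𝔄 ε₄).RegimeTok)
    (h1 : (1 : GaugeField (F.P K) (k + 1) (SU 2)) ∈ dom) (hW : WAnalyticPrTok F 2 K (k + 1) Ω 1 𝔥 levB Gp a hposb hQ εC a₃) (ha : 0 < a𝔄) {aC : ℝ}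
    (hTan : LinPrAnalyticTok F 2 K (k + 1) Ω 1 𝔥 levB a hposb hQ εC aC) (haC : ε₄ + a𝔄 ≤ aC)
    (hu : letI := θ.instVβ₁; letI := θ.instVβ₂;
      ContDiffAt ℝ n (fun B : Fin (F.P K).d → Site (F.P K) (k + 1) → θ.Vβ => coeField (unitField F θ k K B)) 0)
    (htok : letI := θ.instVβ₁; letI := θ.instVβ₂;
      ∀ᶠ B in 𝓝 (0 : Fin (F.P K).d → Site (F.P K) (k + 1) → θ.Vβ),
        (bgSchemePrOfRecord F 2 K (k + 1) Ω 1 𝔥 dom levB Gp Δ2 a hposπ hposb hQ εC B₀ C₄ a₃ j a𝔄 ε₄).LieLinTokAt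
          (linPrOfRecord F 2 K (k + 1) Ω 1 𝔥 levB a hposb hQ εC) (unitField F θ k K B)) :
    letI := θ.instVβ₁; letI := θ.instVβ₂
    ContDiffAt ℝ n (fun (B : Fin (F.P K).d → Site (F.P K) (k + 1) → θ.Vβ) (b : PBond (F.P K) 0) =>
      (((bgSchemePrOfRecord F 2 K (k + 1) Ω 1 𝔥 dom levB Gp Δ2 a hposπ hposb hQ εC B₀ C₄ a₃ j a𝔄 ε₄).chartCfgLin
        (linPrOfRecord F 2 K (k + 1) Ω 1 𝔥 levB a hposb hQ εC) (unitField F θ k K B) b : SU 2) : Matrix (Fin 2) (Fin 2) ℂ)) 0 := by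
  letI := θ.instVβ₁; letI := θ.instVβ₂
  refine bgSchemePrOfRecord_contDiffAt_coe_chartCfgLin_comp_pi_of_regimeTok F 2 K (k + 1) Ω 1 𝔥 dom levB Gp Δ2 a hposπ hposb hQ εC B₀ C₄ a₃ j a𝔄 ε₄
    hT h1 hW hu ?_ hTan haC htok
  show coeField (unitField F θ k K (0 : Fin (F.P K).d → Site (F.P K) (k + 1) → θ.Vβ)) ∈ _
  rw [unitField_zero F θ k K]
  exact coeField_one_mem_logPolydiscPrOfRecord F 2 K (k + 1) Ω 𝔥 levB Gp Δ2 a hposπ hQ a𝔄 ha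

/-- ★★ **THE EVENTUAL (47)-CARRYING LIE TOKEN ALONG THE CHARTED UNIT-LATTICE FIELDS** — the `htok` of the three doors above — from the ball inclusion `hlin` (for `V ∈ dom`,
`T^{pr}_V` maps `evHerm0 ∩ {‖A′‖ < a_C}` into `evHerm0`: supplied by §2's ✓`linPrOfRecord_mem_evHerm0` at `N = 2`, level `k+1`, `U₀ = 1` from the rows `RC` `hH` `hHtr`
`hCreal` `hCtr`), the reality of `𝒜^{pr}(W_B)`, `𝔄^{pr}(W_B)` near `B = 0` (DISPLAYED, eventual), the domain letter, `RegimeTok` and `ε₄ + a𝔄 ≤ a_C` (radius by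
✓`norm_sol_add_frakApr_lt`; token by (A4) ✓`BgScheme.lieLinTokAt_of_mem_evHerm0`). [cite: Balaban1985Variational, (15) p.280, (47) p.285, (51) p.286, Prop. 6 p.295, Prop. 9 p.309] -/
theorem lieLinTokAt_unitField_eventually_prOfRecord {aC : ℝ}
    (hlin : ∀ V ∈ dom, ∀ A' ∈ (bgSchemePrOfRecord F 2 K (k + 1) Ω 1 𝔥 dom levB Gp Δ2 a hposπ hposb hQ εC B₀ C₄ a₃ j a𝔄 ε₄).evHerm0, ‖A'‖ < aC →
      linPrOfRecord F 2 K (k + 1) Ω 1 𝔥 levB a hposb hQ εC V A' ∈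
        (bgSchemePrOfRecord F 2 K (k + 1) Ω 1 𝔥 dom levB Gp Δ2 a hposπ hposb hQ εC B₀ C₄ a₃ j a𝔄 ε₄).evHerm0)
    (hT : (bgSchemePrOfRecord F 2 K (k + 1) Ω 1 𝔥 dom levB Gp Δ2 a hposπ hposb hQ εC B₀ C₄ a₃ j a𝔄 ε₄).RegimeTok) (haC : ε₄ + a𝔄 ≤ aC)
    (hdom : letI := θ.instVβ₁; letI := θ.instVβ₂;
      ∀ᶠ B in 𝓝 (0 : Fin (F.P K).d → Site (F.P K) (k + 1) → θ.Vβ), unitField F θ k K B ∈ dom)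
    (hreal : letI := θ.instVβ₁; letI := θ.instVβ₂;
      ∀ᶠ B in 𝓝 (0 : Fin (F.P K).d → Site (F.P K) (k + 1) → θ.Vβ),
        (bgSchemePrOfRecord F 2 K (k + 1) Ω 1 𝔥 dom levB Gp Δ2 a hposπ hposb hQ εC B₀ C₄ a₃ j a𝔄 ε₄).sol (unitField F θ k K B) ∈
            (bgSchemePrOfRecord F 2 K (k + 1) Ω 1 𝔥 dom levB Gp Δ2 a hposπ hposb hQ εC B₀ C₄ a₃ j a𝔄 ε₄).evHerm0 ∧
          (bgSchemePrOfRecord F 2 K (k + 1) Ω 1 𝔥 dom levB Gp Δ2 a hposπ hposb hQ εC B₀ C₄ a₃ j a𝔄 ε₄).𝔄 (unitField F θ k K B) ∈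
            (bgSchemePrOfRecord F 2 K (k + 1) Ω 1 𝔥 dom levB Gp Δ2 a hposπ hposb hQ εC B₀ C₄ a₃ j a𝔄 ε₄).evHerm0) :
    letI := θ.instVβ₁; letI := θ.instVβ₂
    ∀ᶠ B in 𝓝 (0 : Fin (F.P K).d → Site (F.P K) (k + 1) → θ.Vβ),
      (bgSchemePrOfRecord F 2 K (k + 1) Ω 1 𝔥 dom levB Gp Δ2 a hposπ hposb hQ εC B₀ C₄ a₃ j a𝔄 ε₄).LieLinTokAt
        (linPrOfRecord F 2 K (k + 1) Ω 1 𝔥 levB a hposb hQ εC) (unitField F θ k K B) := by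
  letI := θ.instVβ₁; letI := θ.instVβ₂
  exact (hdom.and hreal).mono fun B hB =>
    BgScheme.lieLinTokAt_of_mem_evHerm0 _ _ (hlin _ hB.1 _ (add_mem hB.2.1 hB.2.2)
      (norm_sol_add_frakApr_lt F 2 K (k + 1) Ω 1 𝔥 dom levB Gp Δ2 a hposπ hposb hQ εC B₀ C₄ a₃ j a𝔄 ε₄ (hT _ hB.1).1 (hT _ hB.1).2.1
        (hT _ hB.1).2.2 haC))
end PrOfRecord

end Summit.QuantumFields.YangMills.Theorems.K0AxCtabUniq
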